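import Literature.NumberTheory.PAdicHodge.BdRPlusEmbedding
import Literature.NumberTheory.PAdicHodge.AinfLog
import HarnessLib

/-!
# Fontaine's `t = log [ε] ∈ B_dR⁺(F)` and `σ(t) = χ(σ)·t`

Let `F` be a `p`-adic local field, `B_dR⁺ = B_dR⁺(F)` (a complete discrete valuation ring with
maximal ideal `(ξ_dR) = (u_dR)`, `u_dR = [ε] - 1`, `BdRPlusDVR`, `BdRPlusTheta`). We construct

* `instAlgebraRatBDeRhamPlus`: `B_dR⁺` as a `ℚ`-algebra (through `ℚ_p ⊆ B_dR⁺`, `qpToBdR`);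
* `logApprox N = L_N(u_dR) = Σ_{m<N} (-1)^m u_dR^(m+1)/(m+1)`, a Cauchy sequence for the
  `(ξ_dR)`-adic topology (`logApprox_sub_logApprox_mem`);
* **`tBdR`**, Fontaine's **`t = log [ε] = lim_N L_N(u_dR)`** (`B_dR⁺` is `(ξ_dR)`-adically complete),
  with `L_N(u_dR) - t ∈ (ξ_dR)^N` (`logApprox_sub_tBdR_mem`);
* **`galBdRPlus_tBdR`: `σ(t) = χ(σ)·t`** for every `σ ∈ Γ_F`, `χ` the `p`-adic cyclotomic character
  (`χ(σ) ∈ ℤ_p ⊆ ℚ_p ⊆ B_dR⁺`): at level `N` this is the congruence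
  `Λ_N(σ u) - χ(σ)Λ_N(u) ∈ ξ^(N+1)𝔸_inf` of `AinfLog` (`σ u = [ε^{χ(σ)}] - 1`), and `B_dR⁺` is
  `(ξ_dR)`-adically separated;
* `tBdR_sub_uBdR_mem`, **`exists_tBdR_eq_uBdR_mul`**: `t ≡ u_dR (mod ξ_dR²)`, so `t = u_dR · (unit)`
  is a uniformizer of `B_dR⁺`: `t ≠ 0`, `t ∈ (ξ_dR) = ker θ` (`tBdR_mem_span_xiBdR`); with `maximalIdeal_bDeRhamPlus_eq_span_uBdR` the maximal ideal of
  `B_dR⁺` is `(t)`.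

This is Fontaine 1994, Exp. II, 1.5.4–1.5.5 (`t` generates `Fil¹ = ker θ` and `Γ_F` acts on `t`
through `χ`), with the analytic logarithm replaced by its truncations (`TruncatedLog`, `AinfLog`).

## References
* [FontaineAsterisque223III] J.-M. Fontaine, *Le corps des périodes p-adiques*, Astérisque 223
  (1994), Exp. II, §1.5.4–1.5.5.
* [FontaineOuyang2022] J.-M. Fontaine, Y. Ouyang, *Theory of p-adic Galois representations*,
  §5.1.2, Prop. 5.1.6.
-/

noncomputable section

open ValuativeRel Field Ideal WittVector UniformSpace
open Literature.AlgebraicGeometry.Resolution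

namespace Literature.NumberTheory.PAdicHodge

open Literature.NumberTheory.GaloisRepresentations
open Literature.NumberTheory.GaloisRepresentations.IsNonarchimedeanLocalField
open TruncatedLog

variable {F : Type} [Field F] [ValuativeRel F] [TopologicalSpace F] [IsNonarchimedeanLocalField F]
  [CharZero F] {p : ℕ} [Fact p.Prime] [Fact (¬ IsUnit (p : integerC F))]
  [IsAdicComplete (Ideal.span {(p : integerC F)}) (integerC F)]

/-! ### `B_dR⁺` is a `ℚ`-algebra -/

/-- `B_dR⁺(F)` is a `ℚ`-algebra, through `ℚ ⊆ ℚ_p → B_dR⁺` (`qpToBdR`). [folklore] -/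
instance instAlgebraRatBDeRhamPlus : Algebra ℚ (BDeRhamPlus (integerC F) p) :=
  ((qpToBdR (F := F) (p := p)).comp (algebraMap ℚ ℚ_[p])).toAlgebra

omit [CharZero F] in
/-- Unfolding: `algebraMap ℚ B_dR⁺ q = qpToBdR q`. [folklore] -/
theorem algebraMap_rat_bDeRhamPlus (q : ℚ) :
    algebraMap ℚ (BDeRhamPlus (integerC F) p) q = qpToBdR (algebraMap ℚ ℚ_[p] q) := rfl

omit [CharZero F] in
/-- Nonzero naturals are units in `B_dR⁺`. [folklore] -/
theorem isUnit_natCast_bDeRhamPlus {n : ℕ} (hn : n ≠ 0) : IsUnit (n : BDeRhamPlus (integerC F) p) := by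
  rw [← map_natCast (algebraMap ℚ (BDeRhamPlus (integerC F) p))]
  exact (Ne.isUnit (by exact_mod_cast hn : (n : ℚ) ≠ 0)).map _

/-- Ring endomorphisms `σ ∈ Γ_F` of `B_dR⁺` fix `ℚ`. [folklore] -/
theorem galBdRPlus_algebraMap_rat (σ : absoluteGaloisGroup F) (q : ℚ) :
    galBdRPlus σ (algebraMap ℚ (BDeRhamPlus (integerC F) p) q) = algebraMap ℚ _ q := by
  rw [algebraMap_rat_bDeRhamPlus, galBdRPlus_qpToBdR]

omit [CharZero F] in
/-- `ainfToBdR` commutes with evaluation of integer polynomials. [folklore] -/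
theorem ainfToBdR_aeval (x : Ainf (p := p) F) (q : Polynomial ℤ) :
    ainfToBdR (Polynomial.aeval x q) = Polynomial.aeval (ainfToBdR x) q :=
  (Polynomial.aeval_algHom_apply ((ainfToBdR (F := F) (p := p)).toIntAlgHom) x q).symm

/-! ### The ideal `(ξ_dR)` and its powers -/

/-- `u_dR ∈ (ξ_dR)`. [folklore] -/
theorem uBdR_mem_span_xiBdR : (uBdR : BDeRhamPlus (integerC F) p) ∈ Ideal.span {xiBdR} := by
  obtain ⟨c, hc⟩ := xi_dvd_uAinf (F := F) (p := p)
  refine Ideal.mem_span_singleton'.2 ⟨ainfToBdR c, ?_⟩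
  rw [← ainfToBdR_uAinf, hc, map_mul, ainfToBdR_xi, mul_comm]

/-- `B_dR⁺` is `(ξ_dR)`-adically complete. [cite: FontaineAsterisque223III, Exp. II §1.5] -/
theorem isAdicComplete_span_xiBdR :
    IsAdicComplete (Ideal.span {(xiBdR : BDeRhamPlus (integerC F) p)}) (BDeRhamPlus (integerC F) p) := by
  rw [← map_ker_eq_span_xiBdR]
  exact isAdicComplete_bDeRhamPlus

/-- `Γ_F` preserves `(ξ_dR)^N`. [folklore] -/
theorem galBdRPlus_mem_span_pow (σ : absoluteGaloisGroup F) (N : ℕ) {b : BDeRhamPlus (integerC F) p}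
    (hb : b ∈ Ideal.span {(xiBdR : BDeRhamPlus (integerC F) p)} ^ N) :
    galBdRPlus σ b ∈ Ideal.span {(xiBdR : BDeRhamPlus (integerC F) p)} ^ N := by
  rw [Ideal.span_singleton_pow, Ideal.mem_span_singleton'] at hb ⊢
  obtain ⟨c, rfl⟩ := hb
  obtain ⟨d, hd⟩ := Ideal.mem_span_singleton'.1
    (galBdRPlus_mem_span σ (Ideal.mem_span_singleton_self (xiBdR : BDeRhamPlus (integerC F) p)))
  exact ⟨galBdRPlus σ c * d ^ N, by rw [map_mul, map_pow, ← hd]; ring⟩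

/-! ### The truncated logarithms `L_N(u_dR)` -/

/-- **`L_N(u_dR) = Σ_{m<N} (-1)^m u_dR^(m+1)/(m+1) ∈ B_dR⁺`.** [cite: FontaineAsterisque223III, Exp. II §1.5.4] -/
def logApprox (N : ℕ) : BDeRhamPlus (integerC F) p :=
  Polynomial.aeval (uBdR : BDeRhamPlus (integerC F) p) (logTrunc N)

/-- Unfolding of `logApprox`. [folklore] -/
theorem logApprox_def (N : ℕ) :
    (logApprox N : BDeRhamPlus (integerC F) p) = Polynomial.aeval (uBdR : BDeRhamPlus (integerC F) p) (logTrunc N) := rfl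

/-- `L_{N+1}(u) = L_N(u) + (-1)^N/(N+1) · u^(N+1)`. [folklore] -/
theorem logApprox_succ (N : ℕ) :
    (logApprox (N + 1) : BDeRhamPlus (integerC F) p) =
      logApprox N + algebraMap ℚ _ ((-1 : ℚ) ^ N / (N + 1)) * uBdR ^ (N + 1) :=
  aeval_logTrunc_succ _ _

/-- The sequence `L_N(u)` is Cauchy: `L_N(u) - L_M(u) ∈ (ξ_dR)^M` for `M ≤ N`. [folklore] -/
theorem logApprox_sub_logApprox_mem {M N : ℕ} (h : M ≤ N) :
    (logApprox N - logApprox M : BDeRhamPlus (integerC F) p) ∈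
      Ideal.span {(xiBdR : BDeRhamPlus (integerC F) p)} ^ M := by
  induction N, h using Nat.le_induction with
  | base => rw [sub_self]; exact Submodule.zero_mem _
  | succ N hMN ih =>
    rw [logApprox_succ, add_sub_right_comm]
    refine add_mem ih (Ideal.mul_mem_left _ _ ?_)
    exact Ideal.pow_le_pow_right (by omega) (Ideal.pow_mem_pow uBdR_mem_span_xiBdR (N + 1))

/-- `Γ_F` acts on `L_N(u)` through `u`: `σ(L_N(u)) = L_N(σ u)`. [folklore] -/
theorem galBdRPlus_logApprox (σ : absoluteGaloisGroup F) (N : ℕ) :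
    galBdRPlus σ (logApprox N : BDeRhamPlus (integerC F) p) =
      Polynomial.aeval (galBdRPlus σ (uBdR : BDeRhamPlus (integerC F) p)) (logTrunc N) := by
  simp only [logApprox_def, aeval_logTrunc, map_sum, map_mul, map_pow, galBdRPlus_algebraMap_rat]

/-- **The finite-level transformation law `σ(L_N(u)) - χ(σ)·L_N(u) ∈ (ξ_dR)^(N+1)`** (image of
`AinfLog.aeval_logTruncInt_galAinf_uAinf_sub_mem`, divided by the unit `N!`).
[cite: FontaineAsterisque223III, Exp. II §1.5.4] -/
theorem galBdRPlus_logApprox_sub_mem (σ : absoluteGaloisGroup F) (N : ℕ) :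
    galBdRPlus σ (logApprox N : BDeRhamPlus (integerC F) p) -
        qpToBdR (((GaloisRep.cyclotomicCharacter F p σ : ℤ_[p]ˣ) : ℤ_[p]) : ℚ_[p]) * logApprox N ∈
      Ideal.span {(xiBdR : BDeRhamPlus (integerC F) p)} ^ (N + 1) := by
  have h := Ideal.mem_map_of_mem (ainfToBdR (F := F) (p := p))
    (aeval_logTruncInt_galAinf_uAinf_sub_mem (F := F) (p := p) σ N)
  rw [Ideal.map_span, Set.image_singleton, map_pow, ainfToBdR_xi, ← Ideal.span_singleton_pow,
    map_sub, map_mul, ainfToBdR_aeval, ainfToBdR_aeval, ← galBdRPlus_ainfToBdR, ainfToBdR_uAinf,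
    ← qpToBdR_coe, aeval_logTruncInt, aeval_logTruncInt, ← logApprox_def, mul_left_comm, ← mul_sub,
    Ideal.unit_mul_mem_iff_mem _ (isUnit_natCast_bDeRhamPlus (Nat.factorial_ne_zero N)),
    ← galBdRPlus_logApprox] at h
  exact h

/-! ### `t = log [ε]` -/

/-- Existence of the limit `lim_N L_N(u)` in the `(ξ_dR)`-adically complete ring `B_dR⁺`. [folklore] -/
theorem exists_tBdR : ∃ t : BDeRhamPlus (integerC F) p,
    ∀ N, logApprox N - t ∈ Ideal.span {(xiBdR : BDeRhamPlus (integerC F) p)} ^ N := by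
  haveI := isAdicComplete_span_xiBdR (F := F) (p := p)
  have hc : ∀ {m n : ℕ}, m ≤ n → (logApprox m : BDeRhamPlus (integerC F) p) ≡ logApprox n
      [SMOD (Ideal.span {(xiBdR : BDeRhamPlus (integerC F) p)} ^ m • ⊤ :
        Submodule (BDeRhamPlus (integerC F) p) (BDeRhamPlus (integerC F) p))] := by
    intro m n hmn
    rw [smul_eq_mul, Ideal.mul_top, SModEq.sub_mem, ← neg_sub]
    exact neg_mem (logApprox_sub_logApprox_mem hmn)
  obtain ⟨L, hL⟩ := IsPrecomplete.prec
    (IsAdicComplete.toIsPrecomplete (I := Ideal.span {(xiBdR : BDeRhamPlus (integerC F) p)})) hc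
  exact ⟨L, fun N => by
    have h := hL N
    rwa [smul_eq_mul, Ideal.mul_top, SModEq.sub_mem] at h⟩

/-- **Fontaine's `t = log [ε] ∈ B_dR⁺(F)`**: the `(ξ_dR)`-adic limit of `L_N([ε] - 1)`.
[cite: FontaineAsterisque223III, Exp. II §1.5.4] [cite: FontaineOuyang2022, §5.1.2] -/
def tBdR : BDeRhamPlus (integerC F) p := Classical.choose exists_tBdR

/-- `L_N(u) - t ∈ (ξ_dR)^N`. [cite: FontaineAsterisque223III, Exp. II §1.5.4] -/
theorem logApprox_sub_tBdR_mem (N : ℕ) :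
    (logApprox N - tBdR : BDeRhamPlus (integerC F) p) ∈ Ideal.span {(xiBdR : BDeRhamPlus (integerC F) p)} ^ N :=
  Classical.choose_spec exists_tBdR N

/-- **`σ(t) = χ(σ)·t`** for every `σ ∈ Γ_F` (`χ` the `p`-adic cyclotomic character, `χ(σ) ∈ ℤ_p ⊆ ℚ_p ⊆ B_dR⁺`).
[cite: FontaineAsterisque223III, Exp. II §1.5.4–1.5.5] [cite: FontaineOuyang2022, §5.1.2] -/
theorem galBdRPlus_tBdR (σ : absoluteGaloisGroup F) :
    galBdRPlus σ (tBdR : BDeRhamPlus (integerC F) p) =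
      qpToBdR (((GaloisRep.cyclotomicCharacter F p σ : ℤ_[p]ˣ) : ℤ_[p]) : ℚ_[p]) * tBdR := by
  haveI := isAdicComplete_span_xiBdR (F := F) (p := p)
  rw [← sub_eq_zero]
  refine IsHausdorff.haus (IsAdicComplete.toIsHausdorff
    (I := Ideal.span {(xiBdR : BDeRhamPlus (integerC F) p)})) _ fun N => ?_
  rw [smul_eq_mul, Ideal.mul_top, SModEq.zero]
  have h1 := logApprox_sub_tBdR_mem (F := F) (p := p) N
  have h2 : galBdRPlus σ (tBdR - logApprox N) ∈ Ideal.span {(xiBdR : BDeRhamPlus (integerC F) p)} ^ N :=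
    galBdRPlus_mem_span_pow σ N (by rw [← neg_sub]; exact neg_mem h1)
  have h3 := Ideal.pow_le_pow_right (Nat.le_succ N) (galBdRPlus_logApprox_sub_mem (F := F) (p := p) σ N)
  have e : galBdRPlus σ tBdR - qpToBdR (((GaloisRep.cyclotomicCharacter F p σ : ℤ_[p]ˣ) : ℤ_[p]) : ℚ_[p]) * tBdR =
      galBdRPlus σ (tBdR - logApprox N) +
        (galBdRPlus σ (logApprox N) -
          qpToBdR (((GaloisRep.cyclotomicCharacter F p σ : ℤ_[p]ˣ) : ℤ_[p]) : ℚ_[p]) * logApprox N) +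
        qpToBdR (((GaloisRep.cyclotomicCharacter F p σ : ℤ_[p]ˣ) : ℤ_[p]) : ℚ_[p]) * (logApprox N - tBdR) := by
    rw [map_sub]; ring
  rw [e]
  exact add_mem (add_mem h2 h3) (Ideal.mul_mem_left _ _ h1)

/-- `σ • t = χ(σ)·t`. [cite: FontaineAsterisque223III, Exp. II §1.5.5] -/
theorem smul_tBdR (σ : absoluteGaloisGroup F) :
    σ • (tBdR : BDeRhamPlus (integerC F) p) =
      qpToBdR (((GaloisRep.cyclotomicCharacter F p σ : ℤ_[p]ˣ) : ℤ_[p]) : ℚ_[p]) * tBdR :=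
  galBdRPlus_tBdR σ

/-! ### `t` is a uniformizer -/

/-- `t - u_dR ∈ (ξ_dR)²` (`L_N(u) ≡ u mod u²`). [cite: FontaineAsterisque223III, Exp. II §1.5.4] -/
theorem tBdR_sub_uBdR_mem :
    (tBdR - uBdR : BDeRhamPlus (integerC F) p) ∈ Ideal.span {(xiBdR : BDeRhamPlus (integerC F) p)} ^ 2 := by
  have h1 := logApprox_sub_tBdR_mem (F := F) (p := p) 2
  obtain ⟨c, hc⟩ := exists_aeval_logTrunc_sub_self (uBdR : BDeRhamPlus (integerC F) p) (N := 2) (by norm_num)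
  rw [← logApprox_def] at hc
  have h2 : (logApprox 2 - uBdR : BDeRhamPlus (integerC F) p) ∈ Ideal.span {(xiBdR : BDeRhamPlus (integerC F) p)} ^ 2 := by
    rw [hc]
    exact Ideal.mul_mem_right _ _ (Ideal.pow_mem_pow uBdR_mem_span_xiBdR 2)
  have e : (tBdR - uBdR : BDeRhamPlus (integerC F) p) = (logApprox 2 - uBdR) - (logApprox 2 - tBdR) := by ring
  rw [e]
  exact sub_mem h2 h1

/-- **`t ∈ (ξ_dR) = ker θ = Fil¹`** (so `θ(t) = 0`, by `thetaBdR_eq_zero_of_mem_span`). [cite: FontaineAsterisque223III, Exp. II §1.5.4] -/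
theorem tBdR_mem_span_xiBdR :
    (tBdR : BDeRhamPlus (integerC F) p) ∈ Ideal.span {(xiBdR : BDeRhamPlus (integerC F) p)} := by
  have h1 : (tBdR - uBdR : BDeRhamPlus (integerC F) p) ∈ Ideal.span {(xiBdR : BDeRhamPlus (integerC F) p)} :=
    Ideal.pow_le_self two_ne_zero tBdR_sub_uBdR_mem
  have h2 : (tBdR : BDeRhamPlus (integerC F) p) = (tBdR - uBdR) + uBdR := by ring
  rw [h2]
  exact add_mem h1 uBdR_mem_span_xiBdR

/-- **`t = u_dR · w` with `w` a unit: `t` is a uniformizer of `B_dR⁺(F)`.**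
[cite: FontaineAsterisque223III, Exp. II §1.5.4] [cite: FontaineOuyang2022, Prop. 5.1.6] -/
theorem exists_tBdR_eq_uBdR_mul (hF : Function.Surjective (fontaineTheta (integerC F) p)) :
    ∃ w : BDeRhamPlus (integerC F) p, IsUnit w ∧ tBdR = uBdR * w := by
  haveI := isLocalRing_bDeRhamPlus (F := F) (p := p) hF
  obtain ⟨v, hv, huv⟩ := exists_uBdR_eq_xiBdR_mul (F := F) (p := p) hF
  have hJ : Ideal.span {(xiBdR : BDeRhamPlus (integerC F) p)} = Ideal.span {uBdR} := by
    rw [huv]; exact (Ideal.span_singleton_mul_right_unit hv _).symm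
  have h := tBdR_sub_uBdR_mem (F := F) (p := p)
  rw [hJ, Ideal.span_singleton_pow, Ideal.mem_span_singleton'] at h
  obtain ⟨c, hc⟩ := h
  refine ⟨1 + c * uBdR, ?_, by linear_combination -hc⟩
  have hmem : -(c * uBdR) ∈ IsLocalRing.maximalIdeal (BDeRhamPlus (integerC F) p) := by
    rw [maximalIdeal_bDeRhamPlus_eq_span_uBdR hF]
    exact neg_mem (Ideal.mul_mem_left _ _ (Ideal.mem_span_singleton_self _))
  have hu := IsLocalRing.isUnit_one_sub_self_of_mem_nonunits _ hmem
  rwa [sub_neg_eq_add] at hu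

/-- `t = ξ_dR · w` with `w` a unit. [cite: FontaineAsterisque223III, Exp. II §1.5.4] -/
theorem exists_tBdR_eq_xiBdR_mul (hF : Function.Surjective (fontaineTheta (integerC F) p)) :
    ∃ w : BDeRhamPlus (integerC F) p, IsUnit w ∧ tBdR = xiBdR * w := by
  obtain ⟨v, hv, huv⟩ := exists_uBdR_eq_xiBdR_mul (F := F) (p := p) hF
  obtain ⟨w, hw, htw⟩ := exists_tBdR_eq_uBdR_mul (F := F) (p := p) hF
  exact ⟨v * w, hv.mul hw, by rw [htw, huv, mul_assoc]⟩

/-- **`t ≠ 0`** (`B_dR⁺` is a domain and `ξ_dR ≠ 0`). [cite: FontaineAsterisque223III, Exp. II §1.5.4] -/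
theorem tBdR_ne_zero (hF : Function.Surjective (fontaineTheta (integerC F) p)) :
    (tBdR : BDeRhamPlus (integerC F) p) ≠ 0 := by
  haveI := isDomain_bDeRhamPlus (F := F) (p := p) hF
  obtain ⟨w, hw, htw⟩ := exists_tBdR_eq_xiBdR_mul (F := F) (p := p) hF
  have hxi : (xiBdR : BDeRhamPlus (integerC F) p) ≠ 0 := fun h =>
    one_ne_zero (eq_zero_of_xiBdR_mul_eq_zero (F := F) (p := p) (x := 1) (by rw [h, zero_mul]))
  rw [htw]
  exact mul_ne_zero hxi hw.ne_zero

end Literature.NumberTheory.PAdicHodge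

end
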